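import Summits.BirchSwinnertonDyer.BirchSwinnertonDyer.Theorems.SignedLowerHalvesKobayashiMainConjectureSmallImageMuTransferCM
import Summits.BirchSwinnertonDyer.BirchSwinnertonDyer.Theorems.SignedLowerHalvesKobayashiMainConjectureSmallImageCMTransferRecordsE
import Summits.BirchSwinnertonDyer.Rank1Residual.Supersingular.NonsplitCartanDescentRecords03
import HarnessLib

/-!
# Route `SignedLowerHalves`, crux `KobayashiMainConjectureSmallImage` (item stmt-BirchSwinnertonDyer-19002) —
# L4-PUB per-pair records RecordsE: Kobayashi's ± main conjecture for 3 rank-0 CM-EC-partnered non-surjective pairs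
# from PUBLISHED named facts + displayed certificates, NO preprint binder (cell `bsd-ssimc`, seat `bsd-ssimc-k3-c4` gen 4)

HONEST FRAMING: Kobayashi's signed main conjecture at a non-surjective (normaliser-of-non-split-Cartan)
image is OPEN as a class statement; item 4 stays OPEN; nothing here is booked; BSD is not proved by any
of this. These are PER-PAIR theorems. Each one re-derives, for the SAME pair, SAME CM partner and SAME
kernel-certified congruence as the landed L4-CM record (file `SignedLowerHalvesKobayashiMainConjectureSmallImageCMTransferRecordsE.lean`), the conclusion
`KobayashiMainConjecture W p ε` for BOTH signs — but its closure contains NO preprint: the OPEN binder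
`CorpuzLei2025_signedMainConjecture_transfer_OPEN` of the landed record is replaced by PUBLISHED named
facts consumed BY NAME (B. D. Kim 2009 Cor. 2.13 = `BDKim2009.cor213_signedMu_eq_zero_iff_of_torsionIso`;
Kobayashi 2003 Thm. 1.2 and Thm. 4.1 RATIONAL clause; B. D. Kim 2013 Cor. 3.15; Pollack 2003; modularity;
GZK; Pollack–Rubin 2004; the period-unit facts; at `p = 5` Fisher 2012 Thm. 13.2 / 2013 Thm. 5.8 `hF`) plus the pair's own `BSD(E,p)`, which the tree
settles per pair by the b2b lane's flag-free exact-descent theorems `bsdp3_nn<label>` / `bsdp_s<label>`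
(GZK + `r_an ≤ 1` + `p ∤ #Ш_an` + ONE certificate line `#Sel^(p)(E/ℚ) = p^(r_an)`), whose binders are
passed through and DISPLAYED (`hr`, `hs`, `hvs`, `hSel`). Mechanism (class theorems
`kobayashiMainConjecture_of_cmPartner_of_bsdp_of_analyticRank_eq_zero` /
`…_of_lvalue_of_bsdp_…`, file `…SmallImageMuTransferCM.lean`): Pollack–Rubin + the partner's
`μ(L_p^±(E')) = 0` ⟹ `μ(X^±(E')) = 0` ⟹ (Kim 2009, along the certified `E[p] ≃ E'[p]`) `μ(X^±(E)) = 0` ⟹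
Kobayashi's RATIONAL Kato divisibility is INTEGRAL (Gauss' lemma in `Λ`) ⟹ with `r_an = 0` and
`BSD(E,p)` the constant-term squeeze (Kim 2013 + GZK + Kobayashi (3.6) + period units) gives the
EQUALITY. The partner data (`card_*`, `hasCM_*`) and the Hesse / `c₄`, `c₆` identities are those of the
landed record (imported / re-checked by `norm_num`, `decide`). Non-kernel inputs per pair, all
displayed: the partner certificate (`hL'` unit case / `hμ'` two-engine `μ`-certificate — values and
engines quoted in the landed record's docstring), Cremona's `r_an = 0` and `#Ш_an`, the descent line.

PARTITION (cell bsd-ssimc): X7 (A7) × 3 of item 4's 76 rank-0 CM-EC-partnered pairs —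
types-the-object-of (per-pair kernel records at the «published + certificates» tier); closes NONE.

References: [BDKim2009] Cor. 2.13; [Kobayashi2003] Thm. 1.2, Thm. 4.1, (3.6), Conjecture (p. 2);
[PollackRubin2004] Thm. (p. 448); [BDKim2013] Cor. 3.15; [Fisher2012Hessian] §13; [Cremona2006];
[Miller2011LMS] Def. 1.1; [SchaeferStoll2004] (the descent certificates, via the cited tree theorems).
-/

set_option autoImplicit false
set_option linter.dupNamespace false

noncomputable section

open scoped Classical MatrixGroups ModularForm

open CongruenceSubgroup WeierstrassCurve Literature.NumberTheory.EllipticCurves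
  Literature.NumberTheory.EllipticCurves.ModularForms
  Literature.NumberTheory.EllipticCurves.Kobayashi2003 ZpExtension
  Literature.NumberTheory.EllipticCurves.GreenbergVatsal2000
  Literature.NumberTheory.EllipticCurves.BDKim2009
  Literature.NumberTheory.EllipticCurves.Rank1Residual
  Literature.NumberTheory.EllipticCurves.Rank1Residual.Typed
  Literature.NumberTheory.EllipticCurves.Rank1Residual.X11RankOneCertificates
  Literature.NumberTheory.EllipticCurves.Fisher2012
  Summit.BirchSwinnertonDyer.BirchSwinnertonDyer.Rank1Residual.IntModel
  Summit.BirchSwinnertonDyer.BirchSwinnertonDyer.Rank1Residual.X11RankOne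
  Summit.BirchSwinnertonDyer.Rank1Residual.X11b
  Summit.BirchSwinnertonDyer.Rank1Residual.X9
  Summit.BirchSwinnertonDyer.Rank1Residual.X1
  Summit.BirchSwinnertonDyer.Rank1Residual.Supersingular

namespace Summit.BirchSwinnertonDyer.BirchSwinnertonDyer.Theorems

/-- **Kobayashi's ± main conjecture, BOTH signs, for `101952bs1 @ 5` (Cremona model `[0, 0, 0, -174420, 22043448]`, analytic rank `0`; item-4 pair:
X7, `a_5 = 0`, image `5Nn`) from PUBLISHED named facts + displayed certificates — NO preprint binder.** Same CM partner `A`,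
same kernel-certified congruence `E[5] ≃ E'[5]` (Hesse pencil identity, `norm_num`) and same partner certificate as the landed
L4-CM record `kobayashiMainConjecture_c101952bs1_5_of_transfer_OPEN` (file `SignedLowerHalvesKobayashiMainConjectureSmallImageCMTransferRecordsE.lean`), whose OPEN binder `hCL` (Corpuz–Lei 2025, PRE) is
REPLACED by: B. D. Kim 2009 Cor. 2.13 (`h09`), Kobayashi 2003 Thm. 1.2 / 4.1-rational (`h12`, `h41`), B. D. Kim 2013 Cor. 3.15 (`hKim`),
Pollack (`hPollack`), modularity (`hmod`, `hmod'`), GZK (`hGZK`) — all PUBLISHED, by name — plus the pair's own `BSD(E,5)`, taken from the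
tree's flag-free exact-descent theorem `bsdp_s101952bs1` (`NonsplitCartanDescentRecords03.lean`) through its binders, displayed here:
`hr` (`r_an = 0`, Cremona), `hs`/`hvs` (`#Ш_an = s` with `ord_5 s = 0`, Cremona), `hSel` (the certificate line `#Sel^(5)(E/ℚ) = 5^0`,
two-engine exact `5`-descent of the b2b lane, quoted in that theorem's docstring). Partner side: unit case: ONE `L`-value certificate `hL'` for the partner (a `p`-adic unit; `μ(L_p^±(E')) = 0` is then a THEOREM, Kurihara);
BY NAME `hPR`, `h5`, `h3`, `hF`. Chain: `kobayashiMainConjecture_of_cmPartner_of_lvalue_of_bsdp_of_analyticRank_eq_zero` (μ-transfer ⟹ integral Kato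
divisibility ⟹ constant-term squeeze). Per pair; item 4 stays OPEN; nothing booked; BSD is not proved by any of this.
[cite: BDKim2009, Cor. 2.13 (p. 187)] [cite: PollackRubin2004, Theorem (p. 448) = Thm. 7.3] [cite: Kobayashi2003, Thm. 4.1 (p. 8) and Conjecture (p. 2)]
[cite: Fisher2012Hessian, Thm. 13.2] [cite: Cremona2006, Table 1 (Cremona label 101952bs1)] -/
theorem kobayashiMainConjecture_c101952bs1_5_of_lvalue_of_bsdp
    (h09 : cor213_signedMu_eq_zero_iff_of_torsionIso)
    (hPR : PollackRubin2004.mainTheorem_signedCharIdeal_eq_of_cm)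
    (h12 : Kobayashi2003.thm12_signedSelmerDual_finite_torsion)
    (h41 : Kobayashi2003.thm41_signedCharIdeal_divisibility)
    (hKim : BDKim2013.cor315_signedCharValue_rankZero)
    (h5 : realPeriodRat_eq_unit_mul_plusPeriod) (h3 : realPeriodRat_eq_unit_mul_plusPeriod_three)
    (hPollack : ∀ {V : WeierstrassCurve ℚ} [V.IsElliptic] [V.IsGloballyMinimal] {N : ℕ} [NeZero N]
      {g : CuspForm (Gamma0 N) 2} {q : ℕ} [Fact q.Prime],
      pollack_exists_plusMinusPAdicLFunction (W := V) (f := g) (p := q))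
    (hmod : nonempty_modularParametrizationData) (hmod' : hasEntireLFunction_rat)
    (hGZK : rank_eq_analyticRank_of_analyticRank_le_one)
    (hF : thm132_fiveCongruent_hessePencil)
    (W A : WeierstrassCurve ℚ) [W.IsElliptic] [W.IsGloballyMinimal] [A.IsElliptic] [A.IsGloballyMinimal]
    [Fact (Nat.Prime 5)] (hW : W = ⟨0, 0, 0, -174420, 22043448⟩) (hA : A = ⟨0, 0, 0, 0, -32⟩)
    (hL' : A.entireLFunction 1 / (A.realPeriodRat : ℂ) = ((1 : ℚ) : ℂ))
    (hr : W.analyticRank = 0) {s : ℚ} (hs : shaAn W = (s : ℂ)) (hvs : padicValRat 5 s = 0)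
    (hSel : Nat.card (W.selmerGroup (5 : ℤ)) = 5 ^ W.analyticRank) (ε : ℤˣ) :
    KobayashiMainConjecture W 5 ε := by
  have hIW : integralModelInt W = ⟨0, 0, 0, -174420, 22043448⟩ :=
    integralModelInt_eq_of_map_eq _ (by rw [hW]; ext <;> simp [WeierstrassCurve.map])
  have hIA : integralModelInt A = ⟨0, 0, 0, 0, -32⟩ :=
    integralModelInt_eq_of_map_eq _ (by rw [hA]; ext <;> simp [WeierstrassCurve.map])
  have hΔ : (⟨0, 0, 0, -174420, 22043448⟩ : WeierstrassCurve ℤ).Δ = discOf [0, 0, 0, -174420, 22043448] :=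
    intCurve_Δ 0 0 0 (-174420) 22043448
  have hΔA : (⟨0, 0, 0, 0, -32⟩ : WeierstrassCurve ℤ).Δ = discOf [0, 0, 0, 0, -32] :=
    intCurve_Δ 0 0 0 0 (-32)
  have hgood : W.HasGoodReductionAtPrime 5 :=
    hasGoodReductionAtPrime_of_not_dvd W 5 (by rw [minimalDiscriminantInt_eq hIW, hΔ]; decide +kernel)
  have hgoodA : A.HasGoodReductionAtPrime 5 :=
    hasGoodReductionAtPrime_of_not_dvd A 5 (by rw [minimalDiscriminantInt_eq hIA, hΔA]; decide +kernel)
  have hap : W.frobeniusTrace 5 = 0 := by rw [frobeniusTrace_eq hIW card_c101952bs1_5]; norm_num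
  have hapA : A.frobeniusTrace 5 = 0 := by rw [frobeniusTrace_eq hIA card_cm0m32_5]; norm_num
  have hc4 : W.c₄ = (8372160 : ℚ) := by
    subst hW; norm_num [WeierstrassCurve.c₄, WeierstrassCurve.b₂, WeierstrassCurve.b₄]
  have hc6 : W.c₆ = (-19045539072 : ℚ) := by
    subst hW; norm_num [WeierstrassCurve.c₆, WeierstrassCurve.b₂, WeierstrassCurve.b₄, WeierstrassCurve.b₆]
  have hc4A : A.c₄ = (0 : ℚ) := by
    subst hA; norm_num [WeierstrassCurve.c₄, WeierstrassCurve.b₂, WeierstrassCurve.b₄]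
  have hc6A : A.c₆ = (27648 : ℚ) := by
    subst hA; norm_num [WeierstrassCurve.c₆, WeierstrassCurve.b₂, WeierstrassCurve.b₄, WeierstrassCurve.b₆]
  have hiso := fiveCongruent_of_hesseCertificate hF A W (96 : ℚ) 1 (3057647616 : ℚ)
    (by norm_num) (by rw [hc4A, hc6A, hc4, eval_hesseC4]; norm_num)
    (by rw [hc4A, hc6A, hc6, eval_hesseC6]; norm_num)
  exact kobayashiMainConjecture_of_cmPartner_of_lvalue_of_bsdp_of_analyticRank_eq_zero W A 5 h09 hPR h12
    h41 hKim h5 h3 hPollack hmod hmod' hGZK (by norm_num)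
    hgood hap (hasCM_cm0m32 hIA) hgoodA hapA hiso (by norm_num) hL'
    (by rw [show (1 : ℚ) = ((1 : ℕ) : ℚ) / (1 : ℕ) by norm_num]
        exact padicValRat_natCast_div_natCast_eq_zero 5 1 1 (by norm_num) (by norm_num)) hr
    (bsdp_s101952bs1 hGZK W hW (hr.trans_le zero_le_one) hs hvs hSel) ε

/-- **Kobayashi's ± main conjecture, BOTH signs, for `105408z1 @ 5` (Cremona model `[0, 0, 0, -19194180, 32367000792]`, analytic rank `0`; item-4 pair:
X7, `a_5 = 0`, image `5Nn`) from PUBLISHED named facts + displayed certificates — NO preprint binder.** Same CM partner `A`,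
same kernel-certified congruence `E[5] ≃ E'[5]` (Hesse pencil identity, `norm_num`) and same partner certificate as the landed
L4-CM record `kobayashiMainConjecture_c105408z1_5_of_transfer_OPEN` (file `SignedLowerHalvesKobayashiMainConjectureSmallImageCMTransferRecordsE.lean`), whose OPEN binder `hCL` (Corpuz–Lei 2025, PRE) is
REPLACED by: B. D. Kim 2009 Cor. 2.13 (`h09`), Kobayashi 2003 Thm. 1.2 / 4.1-rational (`h12`, `h41`), B. D. Kim 2013 Cor. 3.15 (`hKim`),
Pollack (`hPollack`), modularity (`hmod`, `hmod'`), GZK (`hGZK`) — all PUBLISHED, by name — plus the pair's own `BSD(E,5)`, taken from the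
tree's flag-free exact-descent theorem `bsdp_s105408z1` (`NonsplitCartanDescentRecords03.lean`) through its binders, displayed here:
`hr` (`r_an = 0`, Cremona), `hs`/`hvs` (`#Ш_an = s` with `ord_5 s = 0`, Cremona), `hSel` (the certificate line `#Sel^(5)(E/ℚ) = 5^0`,
two-engine exact `5`-descent of the b2b lane, quoted in that theorem's docstring). Partner side: unit case: ONE `L`-value certificate `hL'` for the partner (a `p`-adic unit; `μ(L_p^±(E')) = 0` is then a THEOREM, Kurihara);
BY NAME `hPR`, `h5`, `h3`, `hF`. Chain: `kobayashiMainConjecture_of_cmPartner_of_lvalue_of_bsdp_of_analyticRank_eq_zero` (μ-transfer ⟹ integral Kato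
divisibility ⟹ constant-term squeeze). Per pair; item 4 stays OPEN; nothing booked; BSD is not proved by any of this.
[cite: BDKim2009, Cor. 2.13 (p. 187)] [cite: PollackRubin2004, Theorem (p. 448) = Thm. 7.3] [cite: Kobayashi2003, Thm. 4.1 (p. 8) and Conjecture (p. 2)]
[cite: Fisher2012Hessian, Thm. 13.2] [cite: Cremona2006, Table 1 (Cremona label 105408z1)] -/
theorem kobayashiMainConjecture_c105408z1_5_of_lvalue_of_bsdp
    (h09 : cor213_signedMu_eq_zero_iff_of_torsionIso)
    (hPR : PollackRubin2004.mainTheorem_signedCharIdeal_eq_of_cm)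
    (h12 : Kobayashi2003.thm12_signedSelmerDual_finite_torsion)
    (h41 : Kobayashi2003.thm41_signedCharIdeal_divisibility)
    (hKim : BDKim2013.cor315_signedCharValue_rankZero)
    (h5 : realPeriodRat_eq_unit_mul_plusPeriod) (h3 : realPeriodRat_eq_unit_mul_plusPeriod_three)
    (hPollack : ∀ {V : WeierstrassCurve ℚ} [V.IsElliptic] [V.IsGloballyMinimal] {N : ℕ} [NeZero N]
      {g : CuspForm (Gamma0 N) 2} {q : ℕ} [Fact q.Prime],
      pollack_exists_plusMinusPAdicLFunction (W := V) (f := g) (p := q))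
    (hmod : nonempty_modularParametrizationData) (hmod' : hasEntireLFunction_rat)
    (hGZK : rank_eq_analyticRank_of_analyticRank_le_one)
    (hF : thm132_fiveCongruent_hessePencil)
    (W A : WeierstrassCurve ℚ) [W.IsElliptic] [W.IsGloballyMinimal] [A.IsElliptic] [A.IsGloballyMinimal]
    [Fact (Nat.Prime 5)] (hW : W = ⟨0, 0, 0, -19194180, 32367000792⟩) (hA : A = ⟨0, 0, 0, 0, -32⟩)
    (hL' : A.entireLFunction 1 / (A.realPeriodRat : ℂ) = ((1 : ℚ) : ℂ))
    (hr : W.analyticRank = 0) {s : ℚ} (hs : shaAn W = (s : ℂ)) (hvs : padicValRat 5 s = 0)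
    (hSel : Nat.card (W.selmerGroup (5 : ℤ)) = 5 ^ W.analyticRank) (ε : ℤˣ) :
    KobayashiMainConjecture W 5 ε := by
  have hIW : integralModelInt W = ⟨0, 0, 0, -19194180, 32367000792⟩ :=
    integralModelInt_eq_of_map_eq _ (by rw [hW]; ext <;> simp [WeierstrassCurve.map])
  have hIA : integralModelInt A = ⟨0, 0, 0, 0, -32⟩ :=
    integralModelInt_eq_of_map_eq _ (by rw [hA]; ext <;> simp [WeierstrassCurve.map])
  have hΔ : (⟨0, 0, 0, -19194180, 32367000792⟩ : WeierstrassCurve ℤ).Δ = discOf [0, 0, 0, -19194180, 32367000792] :=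
    intCurve_Δ 0 0 0 (-19194180) 32367000792
  have hΔA : (⟨0, 0, 0, 0, -32⟩ : WeierstrassCurve ℤ).Δ = discOf [0, 0, 0, 0, -32] :=
    intCurve_Δ 0 0 0 0 (-32)
  have hgood : W.HasGoodReductionAtPrime 5 :=
    hasGoodReductionAtPrime_of_not_dvd W 5 (by rw [minimalDiscriminantInt_eq hIW, hΔ]; decide +kernel)
  have hgoodA : A.HasGoodReductionAtPrime 5 :=
    hasGoodReductionAtPrime_of_not_dvd A 5 (by rw [minimalDiscriminantInt_eq hIA, hΔA]; decide +kernel)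
  have hap : W.frobeniusTrace 5 = 0 := by rw [frobeniusTrace_eq hIW card_c105408z1_5]; norm_num
  have hapA : A.frobeniusTrace 5 = 0 := by rw [frobeniusTrace_eq hIA card_cm0m32_5]; norm_num
  have hc4 : W.c₄ = (921320640 : ℚ) := by
    subst hW; norm_num [WeierstrassCurve.c₄, WeierstrassCurve.b₂, WeierstrassCurve.b₄]
  have hc6 : W.c₆ = (-27965088684288 : ℚ) := by
    subst hW; norm_num [WeierstrassCurve.c₆, WeierstrassCurve.b₂, WeierstrassCurve.b₄, WeierstrassCurve.b₆]
  have hc4A : A.c₄ = (0 : ℚ) := by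
    subst hA; norm_num [WeierstrassCurve.c₄, WeierstrassCurve.b₂, WeierstrassCurve.b₄]
  have hc6A : A.c₆ = (27648 : ℚ) := by
    subst hA; norm_num [WeierstrassCurve.c₆, WeierstrassCurve.b₂, WeierstrassCurve.b₄, WeierstrassCurve.b₆]
  have hiso := fiveCongruent_of_hesseCertificate hF A W (-96 : ℚ) 1 (1019215872 : ℚ)
    (by norm_num) (by rw [hc4A, hc6A, hc4, eval_hesseC4]; norm_num)
    (by rw [hc4A, hc6A, hc6, eval_hesseC6]; norm_num)
  exact kobayashiMainConjecture_of_cmPartner_of_lvalue_of_bsdp_of_analyticRank_eq_zero W A 5 h09 hPR h12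
    h41 hKim h5 h3 hPollack hmod hmod' hGZK (by norm_num)
    hgood hap (hasCM_cm0m32 hIA) hgoodA hapA hiso (by norm_num) hL'
    (by rw [show (1 : ℚ) = ((1 : ℕ) : ℚ) / (1 : ℕ) by norm_num]
        exact padicValRat_natCast_div_natCast_eq_zero 5 1 1 (by norm_num) (by norm_num)) hr
    (bsdp_s105408z1 hGZK W hW (hr.trans_le zero_le_one) hs hvs hSel) ε

/-- **Kobayashi's ± main conjecture, BOTH signs, for `105408l1 @ 5` (Cremona model `[0, 0, 0, -172747620, 873909021384]`, analytic rank `0`; item-4 pair: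
X7, `a_5 = 0`, image `5Nn`) from PUBLISHED named facts + displayed certificates — NO preprint binder.** Same CM partner `A`,
same kernel-certified congruence `E[5] ≃ E'[5]` (Hesse pencil identity, `norm_num`) and same partner certificate as the landed
L4-CM record `kobayashiMainConjecture_c105408l1_5_of_transfer_OPEN` (file `SignedLowerHalvesKobayashiMainConjectureSmallImageCMTransferRecordsE.lean`), whose OPEN binder `hCL` (Corpuz–Lei 2025, PRE) is
REPLACED by: B. D. Kim 2009 Cor. 2.13 (`h09`), Kobayashi 2003 Thm. 1.2 / 4.1-rational (`h12`, `h41`), B. D. Kim 2013 Cor. 3.15 (`hKim`),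
Pollack (`hPollack`), modularity (`hmod`, `hmod'`), GZK (`hGZK`) — all PUBLISHED, by name — plus the pair's own `BSD(E,5)`, taken from the
tree's flag-free exact-descent theorem `bsdp_s105408l1` (`NonsplitCartanDescentRecords03.lean`) through its binders, displayed here:
`hr` (`r_an = 0`, Cremona), `hs`/`hvs` (`#Ш_an = s` with `ord_5 s = 0`, Cremona), `hSel` (the certificate line `#Sel^(5)(E/ℚ) = 5^0`,
two-engine exact `5`-descent of the b2b lane, quoted in that theorem's docstring). Partner side: unit case: ONE `L`-value certificate `hL'` for the partner (a `p`-adic unit; `μ(L_p^±(E')) = 0` is then a THEOREM, Kurihara);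
BY NAME `hPR`, `h5`, `h3`, `hF`. Chain: `kobayashiMainConjecture_of_cmPartner_of_lvalue_of_bsdp_of_analyticRank_eq_zero` (μ-transfer ⟹ integral Kato
divisibility ⟹ constant-term squeeze). Per pair; item 4 stays OPEN; nothing booked; BSD is not proved by any of this.
[cite: BDKim2009, Cor. 2.13 (p. 187)] [cite: PollackRubin2004, Theorem (p. 448) = Thm. 7.3] [cite: Kobayashi2003, Thm. 4.1 (p. 8) and Conjecture (p. 2)]
[cite: Fisher2012Hessian, Thm. 13.2] [cite: Cremona2006, Table 1 (Cremona label 105408l1)] -/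
theorem kobayashiMainConjecture_c105408l1_5_of_lvalue_of_bsdp
    (h09 : cor213_signedMu_eq_zero_iff_of_torsionIso)
    (hPR : PollackRubin2004.mainTheorem_signedCharIdeal_eq_of_cm)
    (h12 : Kobayashi2003.thm12_signedSelmerDual_finite_torsion)
    (h41 : Kobayashi2003.thm41_signedCharIdeal_divisibility)
    (hKim : BDKim2013.cor315_signedCharValue_rankZero)
    (h5 : realPeriodRat_eq_unit_mul_plusPeriod) (h3 : realPeriodRat_eq_unit_mul_plusPeriod_three)
    (hPollack : ∀ {V : WeierstrassCurve ℚ} [V.IsElliptic] [V.IsGloballyMinimal] {N : ℕ} [NeZero N]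
      {g : CuspForm (Gamma0 N) 2} {q : ℕ} [Fact q.Prime],
      pollack_exists_plusMinusPAdicLFunction (W := V) (f := g) (p := q))
    (hmod : nonempty_modularParametrizationData) (hmod' : hasEntireLFunction_rat)
    (hGZK : rank_eq_analyticRank_of_analyticRank_le_one)
    (hF' : thm58_fiveCongruent_hessePencilInd)
    (W A : WeierstrassCurve ℚ) [W.IsElliptic] [W.IsGloballyMinimal] [A.IsElliptic] [A.IsGloballyMinimal]
    [Fact (Nat.Prime 5)] (hW : W = ⟨0, 0, 0, -172747620, 873909021384⟩) (hA : A = ⟨0, 0, 0, 0, 32⟩)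
    (hL' : A.entireLFunction 1 / (A.realPeriodRat : ℂ) = ((1 : ℚ) : ℂ))
    (hr : W.analyticRank = 0) {s : ℚ} (hs : shaAn W = (s : ℂ)) (hvs : padicValRat 5 s = 0)
    (hSel : Nat.card (W.selmerGroup (5 : ℤ)) = 5 ^ W.analyticRank) (ε : ℤˣ) :
    KobayashiMainConjecture W 5 ε := by
  have hIW : integralModelInt W = ⟨0, 0, 0, -172747620, 873909021384⟩ :=
    integralModelInt_eq_of_map_eq _ (by rw [hW]; ext <;> simp [WeierstrassCurve.map])
  have hIA : integralModelInt A = ⟨0, 0, 0, 0, 32⟩ :=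
    integralModelInt_eq_of_map_eq _ (by rw [hA]; ext <;> simp [WeierstrassCurve.map])
  have hΔ : (⟨0, 0, 0, -172747620, 873909021384⟩ : WeierstrassCurve ℤ).Δ = discOf [0, 0, 0, -172747620, 873909021384] :=
    intCurve_Δ 0 0 0 (-172747620) 873909021384
  have hΔA : (⟨0, 0, 0, 0, 32⟩ : WeierstrassCurve ℤ).Δ = discOf [0, 0, 0, 0, 32] :=
    intCurve_Δ 0 0 0 0 32
  have hgood : W.HasGoodReductionAtPrime 5 :=
    hasGoodReductionAtPrime_of_not_dvd W 5 (by rw [minimalDiscriminantInt_eq hIW, hΔ]; decide +kernel)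
  have hgoodA : A.HasGoodReductionAtPrime 5 :=
    hasGoodReductionAtPrime_of_not_dvd A 5 (by rw [minimalDiscriminantInt_eq hIA, hΔA]; decide +kernel)
  have hap : W.frobeniusTrace 5 = 0 := by rw [frobeniusTrace_eq hIW card_c105408l1_5]; norm_num
  have hapA : A.frobeniusTrace 5 = 0 := by rw [frobeniusTrace_eq hIA card_cm0p32_5]; norm_num
  have hc4 : W.c₄ = (8291885760 : ℚ) := by
    subst hW; norm_num [WeierstrassCurve.c₄, WeierstrassCurve.b₂, WeierstrassCurve.b₄]
  have hc6 : W.c₆ = (-755057394475776 : ℚ) := by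
    subst hW; norm_num [WeierstrassCurve.c₆, WeierstrassCurve.b₂, WeierstrassCurve.b₄, WeierstrassCurve.b₆]
  have hc4A : A.c₄ = (0 : ℚ) := by
    subst hA; norm_num [WeierstrassCurve.c₄, WeierstrassCurve.b₂, WeierstrassCurve.b₄]
  have hc6A : A.c₆ = (-27648 : ℚ) := by
    subst hA; norm_num [WeierstrassCurve.c₆, WeierstrassCurve.b₂, WeierstrassCurve.b₄, WeierstrassCurve.b₆]
  have hiso := fiveCongruent_of_hesseIndCertificate hF' A W (-48 : ℚ) 1 (2348273369088 : ℚ)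
    (by norm_num) (by rw [hc4A, hc6A, hc4, eval_hesseC4ind]; norm_num)
    (by rw [hc4A, hc6A, hc6, eval_hesseC6ind]; norm_num)
  exact kobayashiMainConjecture_of_cmPartner_of_lvalue_of_bsdp_of_analyticRank_eq_zero W A 5 h09 hPR h12
    h41 hKim h5 h3 hPollack hmod hmod' hGZK (by norm_num)
    hgood hap (hasCM_cm0p32 hIA) hgoodA hapA hiso (by norm_num) hL'
    (by rw [show (1 : ℚ) = ((1 : ℕ) : ℚ) / (1 : ℕ) by norm_num]
        exact padicValRat_natCast_div_natCast_eq_zero 5 1 1 (by norm_num) (by norm_num)) hr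
    (bsdp_s105408l1 hGZK W hW (hr.trans_le zero_le_one) hs hvs hSel) ε

end Summit.BirchSwinnertonDyer.BirchSwinnertonDyer.Theorems

end
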